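import Mathlib.Analysis.SpecialFunctions.Pow.Real
import HarnessLib

/-!
# The fuzzed brackets of the sliver barrier constants: `3 ≤ F₁ ≤ 15f`, `0 ≤ F₂ ≤ 3f`
(namespace `Literature.Geometry.Lorentzian.Kerr`.)

Pure real-variable inequalities completing `CarterLayerBarrierConstants`: the offsets of the affine
control `c₁(b₂ − s) − e₁ ≤ q ≤ c₂(b₂ − s) + e₂` of Carter's coefficient before the far turning point
(`CarterLayerTurningPointTortoise`) involve the brackets
`F₁ = 2(3 + E)(r_b + r₊)/(r_t + r₊) + 3 + 2E` and `F₂ = ω²C_b·E/(ω²(r_b + r₊)) + 3 + E`,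
`C_b = 2(r_t + r₊) + (r_t + r₊)²/(r_lo − r₋)`, `r_lo = r₊ + δ/2`, `r_b = r₊ + δ`. With the sliver
geometry `r_b + r₊ ≤ 2(r_t + r₊)`, `r_t + r₊ ≤ 2r_b`, `r₊ − r₋ ≥ 0`, `δ ≤ r_b`, `θ₁r_b ≤ 3δ`,
`0 < θ₁ ≤ 1`, `E ≥ 0` and the fuzz factor `f = 1 + 25E/θ₁`:

* `layerBracket_F₁` — `3 ≤ F₁ ≤ 15f`;
* `layerBracket_F₂` — `0 ≤ C_b`, `0 ≤ F₂ ≤ 3f` (`C_b ≤ 15r_b²/δ`).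

Near-extremal Kerr programme, crux `KappaExplicitWaveDecay` (BF-stable large-`Λ` kernel bound,
sliver case). Folklore arithmetic.

## References
* M. Dafermos, I. Rodnianski, Y. Shlapentokh-Rothman, arXiv:1402.7034 = Ann. of Math. 183 (2016),
  §6.2 (key `DafermosRodnianskiShlapentokhrothman2014`). The algebra is folklore.
-/

noncomputable section

namespace Literature.Geometry.Lorentzian

namespace Kerr

section LayerBrackets

variable {rp rm δ rt Es f θ₁ ω : ℝ}

/-- `3 ≤ F₁ ≤ 15f` for `F₁ = 2(3 + E)(r_b + r₊)/(r_t + r₊) + 3 + 2E` (`r_b + r₊ ≤ 2(r_t + r₊)`,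
`f = 1 + 25E/θ₁`, `0 < θ₁ ≤ 1`, `E ≥ 0`). [folklore] -/
theorem layerBracket_F₁ (hEs0 : 0 ≤ Es) (hθ₁ : 0 < θ₁) (hθ₁1 : θ₁ ≤ 1) (hf : f = 1 + 25 * Es / θ₁)
    (hrtp0 : 0 < rt + rp) (hrbp : 0 ≤ rp + δ + rp) (hrt2 : rp + δ + rp ≤ 2 * (rt + rp)) :
    3 ≤ 2 * (3 + Es) * (rp + δ + rp) / (rt + rp) + 3 + 2 * Es ∧
    2 * (3 + Es) * (rp + δ + rp) / (rt + rp) + 3 + 2 * Es ≤ 15 * f := by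
  have hpos : 0 ≤ 2 * (3 + Es) * (rp + δ + rp) / (rt + rp) :=
    div_nonneg (mul_nonneg (by positivity) hrbp) hrtp0.le
  refine ⟨by linarith only [hpos, hEs0], ?_⟩
  have h1 : 2 * (3 + Es) * (rp + δ + rp) / (rt + rp) ≤ 4 * (3 + Es) := by
    rw [div_le_iff₀ hrtp0]
    have := mul_le_mul_of_nonneg_left hrt2 (show 0 ≤ 2 * (3 + Es) by positivity)
    linarith only [this]
  have h2 : Es ≤ 25 * Es / θ₁ := by
    rw [le_div_iff₀ hθ₁]; nlinarith only [hEs0, hθ₁1, hθ₁]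
  linarith only [h1, h2, hf, hEs0]

/-- `0 ≤ C_b ≤ 15r_b²/δ` and `0 ≤ F₂ ≤ 3f` for the upper bracket (see the module docstring).
[folklore] -/
theorem layerBracket_F₂ (hω : ω ≠ 0) (hEs0 : 0 ≤ Es) (hθ₁ : 0 < θ₁) (hθ₁1 : θ₁ ≤ 1)
    (hf : f = 1 + 25 * Es / θ₁) (hrp : 0 < rp) (hd0 : 0 ≤ rp - rm) (hδ : 0 < δ)
    (hrtp0 : 0 < rt + rp) (hrt1 : rt + rp ≤ 2 * (rp + δ)) (hδθ : θ₁ * (rp + δ) ≤ 3 * δ) :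
    0 ≤ 2 * (rt + rp) + (rt + rp) ^ 2 / (rp + δ / 2 - rm) ∧
    0 ≤ ω ^ 2 * (2 * (rt + rp) + (rt + rp) ^ 2 / (rp + δ / 2 - rm)) *
        (Es / (ω ^ 2 * (rp + δ + rp))) + 3 + Es ∧
    ω ^ 2 * (2 * (rt + rp) + (rt + rp) ^ 2 / (rp + δ / 2 - rm)) *
        (Es / (ω ^ 2 * (rp + δ + rp))) + 3 + Es ≤ 3 * f := by
  set rb := rp + δ with hrb
  set Cb := 2 * (rt + rp) + (rt + rp) ^ 2 / (rp + δ / 2 - rm) with hCbdef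
  have hrb0 : 0 < rb := by rw [hrb]; linarith
  have hδrb : δ ≤ rb := by rw [hrb]; linarith
  have hrbp0 : 0 < rb + rp := by linarith
  have hω2 : 0 < ω ^ 2 := by positivity
  have hden : 0 < rp + δ / 2 - rm := by linarith
  have hCb0 : 0 ≤ Cb := add_nonneg (by linarith only [hrtp0]) (div_nonneg (sq_nonneg _) hden.le)
  have hpos : 0 ≤ ω ^ 2 * Cb * (Es / (ω ^ 2 * (rb + rp))) := by positivity
  refine ⟨hCb0, by linarith only [hpos, hEs0], ?_⟩
  have hCb : Cb ≤ 15 * rb ^ 2 / δ := by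
    rw [hCbdef]
    have h2 : (rt + rp) ^ 2 / (rp + δ / 2 - rm) ≤ (2 * rb) ^ 2 / (δ / 2) :=
      div_le_div₀ (by positivity) (pow_le_pow_left₀ hrtp0.le hrt1 2) (by positivity)
        (by linarith only [hd0])
    have h3 : 2 * (rt + rp) ≤ 4 * rb ^ 2 / δ := by
      rw [le_div_iff₀ hδ]
      have := mul_le_mul_of_nonneg_left hδrb (show 0 ≤ 4 * rb by positivity)
      nlinarith only [hrt1, this, hδ]
    have e : (2 * rb) ^ 2 / (δ / 2) = 8 * rb ^ 2 / δ := by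
      rw [div_eq_div_iff (by positivity) (by positivity)]; ring
    rw [e] at h2
    have : 4 * rb ^ 2 / δ + 8 * rb ^ 2 / δ ≤ 15 * rb ^ 2 / δ := by
      rw [← add_div, div_le_div_iff_of_pos_right hδ]; nlinarith only [sq_nonneg rb]
    linarith only [h2, h3, this]
  have h4 : ω ^ 2 * Cb * (Es / (ω ^ 2 * (rb + rp))) ≤ 45 * Es / θ₁ := by
    have e : ω ^ 2 * Cb * (Es / (ω ^ 2 * (rb + rp))) = Cb * Es / (rb + rp) := by
      field_simp
    rw [e, div_le_div_iff₀ hrbp0 hθ₁]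
    have h5 : Cb * Es * θ₁ ≤ 15 * rb ^ 2 / δ * Es * θ₁ := by
      have := mul_le_mul_of_nonneg_right hCb (show 0 ≤ Es * θ₁ by positivity)
      nlinarith only [this]
    have h6 : 15 * rb ^ 2 / δ * Es * θ₁ ≤ 45 * rb * Es := by
      rw [div_mul_eq_mul_div, div_mul_eq_mul_div, div_le_iff₀ hδ]
      have := mul_le_mul_of_nonneg_left hδθ (show 0 ≤ 15 * rb * Es by positivity)
      nlinarith only [this]
    nlinarith only [h5, h6, hEs0, hrp]
  have h2 : Es ≤ Es / θ₁ := by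
    rw [le_div_iff₀ hθ₁]; nlinarith only [hEs0, hθ₁1, hθ₁]
  have h0 : 0 ≤ Es / θ₁ := by positivity
  have e : 3 * f = 3 + 75 * (Es / θ₁) := by rw [hf]; ring
  have e2 : 45 * Es / θ₁ = 45 * (Es / θ₁) := by ring
  rw [e]
  linarith only [h4, h2, h0, e2]

end LayerBrackets

end Kerr

end Literature.Geometry.Lorentzian

end
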